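import Mathlib

/-!
# Tier7/Line3/CompactGroupSurjIntegral — Haar transfer along a surjective hom of compact groups, and the `T = Z · K`
reduction of a torus integral (seat t7-x1, gen 2; the t7-lead's RESIDUAL MAP row U1, abstract half, STATUS l. 15242)

LINE 3 (t7-plan-3), version (ii), the archimedean factor at a rank-one place (`a_bound`, `a_γ₀` of p1's `DominantSide`,
row 674; memo §2f row (3) [W]): the real group `U(W_A)(F_{ι_j}) ≅ U(1,1)` is `Z · SU(1,1)` with `Z` the central
`U(1)`, and each torus `T_A(F_{ι_j}), T_B(F_{ι_j}) ≅ U(1)²` is `Z · K` with `K = T ∩ SU(1,1) ≅ U(1)`; p1's model rows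
integrate over `K × h K h⁻¹` inside `SU(1,1)`. The passage from the real bi-torus orbital integral over `T_A × T_B`
to the model's is the change of variables along the multiplication `Z × K → T`, `(z, k) ↦ z k` — a continuous
surjective homomorphism of compact abelian groups with kernel `{(1, 1), (−1, −1)}` — followed by the `Z`-invariance
of the integrand (the central characters of `f_v`, `μ_A`, `μ_B` match: Target (H11b), memo §2g `[a + p = 0]`).

This module types that passage in the abstract, Mathlib only:
* `integral_comp_of_surjective`: for a compact group `B`, a topological group `A`, Haar measures of equal total mass
  and a continuous surjective hom `φ : A →* B`, `∫_B F = ∫_A F ∘ φ` (Mathlib's `MonoidHom.measurePreserving`,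
  Haar/Unique + `integral_map`);
* `integral_eq_of_mul_surjective`: for a compact abelian group `T` with closed subgroups `Z`, `K` and `Z · K = T`,
  `∫_T F = ∫_{Z × K} F (z k)` (Haar probability measures);
* `integral_eq_integral_of_invariant`: if moreover `F (z k) = F k` for all `z ∈ Z`, `k ∈ K` (the `Z`-invariance of
  the integrand), then `∫_T F = ∫_K F` — row U1's «`vol(Z)` · the `SU(1,1)` bi-torus integral», with Haar
  probability measures (`vol(Z) = 1`).
The matrices (`U(1,1) = Z · SU(1,1)`, the diagonal torus `= Z · K`, the surjectivity of the multiplication) are the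
companion module `UnitaryOneOneCentre`. Nothing here is about a representation, a test function or a period; that
the real `f_v` restricted to `SU(1,1)` is the model's coefficient stays in words (TYPING-CENSUS T7).
Nothing about (N) or HC_CM; §8(d): NO. Blind lane: Mathlib only; no sorry; axioms ⊆ {propext, Classical.choice, Quot.sound}.
-/

namespace Summit.Ventures.HodgeRepro2.Tier7.Line3.CompactGroupSurjIntegral

open MeasureTheory

/-! ## 1. Haar transfer along a continuous surjective homomorphism onto a compact group -/

section Transfer

variable {A B : Type*} [Group A] [TopologicalSpace A] [IsTopologicalGroup A] [MeasurableSpace A] [BorelSpace A]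
  [Group B] [TopologicalSpace B] [IsTopologicalGroup B] [CompactSpace B] [MeasurableSpace B] [BorelSpace B]

/-- **Haar transfer**: a continuous surjective homomorphism `φ : A →* B` onto a compact group is measure preserving
for Haar measures of equal total mass, so `∫_B F = ∫_A F ∘ φ` (for `F` a.e. strongly measurable). -/
theorem integral_comp_of_surjective (μ : Measure A) [μ.IsHaarMeasure] (ν : Measure B) [ν.IsHaarMeasure]
    (huniv : μ Set.univ = ν Set.univ) (φ : A →* B) (hφ : Continuous φ) (hsurj : Function.Surjective φ)
    (F : B → ℂ) (hF : AEStronglyMeasurable F ν) : ∫ b, F b ∂ν = ∫ a, F (φ a) ∂μ := by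
  have hmp : MeasurePreserving (⇑φ) μ ν := MonoidHom.measurePreserving hφ hsurj huniv
  have hF' : AEStronglyMeasurable F (Measure.map (⇑φ) μ) := by rwa [hmp.map_eq]
  calc ∫ b, F b ∂ν = ∫ b, F b ∂(Measure.map (⇑φ) μ) := by rw [hmp.map_eq]
    _ = ∫ a, F (φ a) ∂μ := integral_map hφ.measurable.aemeasurable hF'

/-- the probability-measure form: `∫_B F = ∫_A F ∘ φ` for Haar probability measures and continuous `F`. -/
theorem integral_comp_of_surjective_prob (μ : Measure A) [μ.IsHaarMeasure] [IsProbabilityMeasure μ]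
    (ν : Measure B) [ν.IsHaarMeasure] [IsProbabilityMeasure ν] (φ : A →* B) (hφ : Continuous φ)
    (hsurj : Function.Surjective φ) (F : B → ℂ) (hF : Continuous F) : ∫ b, F b ∂ν = ∫ a, F (φ a) ∂μ :=
  integral_comp_of_surjective μ ν (by simp) φ hφ hsurj F hF.aestronglyMeasurable

end Transfer

/-! ## 2. The multiplication `Z × K → T` -/

section MulHom

variable {T : Type*} [CommGroup T]

/-- the multiplication `Z × K → T` of two subgroups of a commutative group, as a homomorphism -/
def mulHom (Z K : Subgroup T) : Z × K →* T where
  toFun p := (p.1 : T) * (p.2 : T)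
  map_one' := by simp
  map_mul' p q := by
    simp only [Prod.fst_mul, Prod.snd_mul, Subgroup.coe_mul]
    exact mul_mul_mul_comm _ _ _ _

/-- the multiplication is surjective when `Z · K = T` (every `t` is a product `z k`). -/
theorem surjective_mulHom (Z K : Subgroup T) (hZK : ∀ t : T, ∃ z ∈ Z, ∃ k ∈ K, z * k = t) :
    Function.Surjective (mulHom Z K) := by
  intro t
  obtain ⟨z, hz, k, hk, h⟩ := hZK t
  exact ⟨(⟨z, hz⟩, ⟨k, hk⟩), h⟩

variable [TopologicalSpace T] [ContinuousMul T]

/-- the multiplication is continuous. -/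
theorem continuous_mulHom (Z K : Subgroup T) : Continuous (mulHom Z K) :=
  (continuous_subtype_val.comp continuous_fst).mul (continuous_subtype_val.comp continuous_snd)

end MulHom

/-! ## 3. The `T = Z · K` reduction -/

section Reduction

variable {T : Type*} [CommGroup T] [TopologicalSpace T] [IsTopologicalGroup T] [CompactSpace T]
  [SecondCountableTopology T] [MeasurableSpace T] [BorelSpace T]

/-- **the torus integral as an integral over `Z × K`**: with Haar probability measures on `T` and on `Z × K`
(`Z`, `K` subgroups with `Z · K = T`), `∫_T F = ∫_{Z × K} F (z k)` for continuous `F`. -/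
theorem integral_eq_of_mul_surjective (Z K : Subgroup T) (hZK : ∀ t : T, ∃ z ∈ Z, ∃ k ∈ K, z * k = t)
    (ν : Measure T) [ν.IsHaarMeasure] [IsProbabilityMeasure ν]
    (μ : Measure (Z × K)) [μ.IsHaarMeasure] [IsProbabilityMeasure μ] (F : T → ℂ) (hF : Continuous F) :
    ∫ t, F t ∂ν = ∫ p : Z × K, F ((p.1 : T) * (p.2 : T)) ∂μ := by
  haveI : SecondCountableTopology Z := inferInstanceAs (SecondCountableTopology (Z : Set T))
  haveI : SecondCountableTopology K := inferInstanceAs (SecondCountableTopology (K : Set T))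
  haveI : BorelSpace (Z × K) := Prod.borelSpace
  exact integral_comp_of_surjective_prob μ ν (mulHom Z K) (continuous_mulHom Z K) (surjective_mulHom Z K hZK) F hF

/-- **ROW U1 (abstract half)**: if the integrand is `Z`-invariant — `F (z k) = F k` for `z ∈ Z`, `k ∈ K` (the
central-character matching) — then the integral over the torus `T = Z · K` is the integral over `K` alone, with
Haar probability measures (`vol(Z) = 1`): `∫_T F = ∫_K F`. The measure on `Z × K` is the product of Haar
probability measures on `Z` and `K` (a Haar measure on the product, `Measure.prod.instIsHaarMeasure`). -/
theorem integral_eq_integral_of_invariant (Z K : Subgroup T) (hZK : ∀ t : T, ∃ z ∈ Z, ∃ k ∈ K, z * k = t)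
    (ν : Measure T) [ν.IsHaarMeasure] [IsProbabilityMeasure ν]
    (μZ : Measure Z) [μZ.IsHaarMeasure] [IsProbabilityMeasure μZ]
    (μK : Measure K) [μK.IsHaarMeasure] [IsProbabilityMeasure μK]
    (F : T → ℂ) (hF : Continuous F) (hinv : ∀ z ∈ Z, ∀ k ∈ K, F (z * k) = F k) :
    ∫ t, F t ∂ν = ∫ k : K, F k ∂μK := by
  rw [integral_eq_of_mul_surjective Z K hZK ν (μZ.prod μK) F hF]
  have e : (fun p : Z × K => F ((p.1 : T) * (p.2 : T))) = fun p : Z × K => F (p.2 : T) := by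
    funext p
    exact hinv p.1 p.1.2 p.2 p.2.2
  rw [e]
  have hsnd : MeasurePreserving (Prod.snd : Z × K → K) (μZ.prod μK) μK := measurePreserving_snd
  have hF' : AEStronglyMeasurable (fun k : K => F k) (Measure.map (Prod.snd : Z × K → K) (μZ.prod μK)) := by
    rw [hsnd.map_eq]
    exact (hF.comp continuous_subtype_val).aestronglyMeasurable
  calc ∫ p : Z × K, F (p.2 : T) ∂(μZ.prod μK)
      = ∫ k : K, F k ∂(Measure.map (Prod.snd : Z × K → K) (μZ.prod μK)) :=
        (integral_map measurable_snd.aemeasurable hF').symm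
    _ = ∫ k : K, F k ∂μK := by rw [hsnd.map_eq]

end Reduction

end Summit.Ventures.HodgeRepro2.Tier7.Line3.CompactGroupSurjIntegral
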